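/-
COR-CM (cell pub-hodgecm2, stage 2 of the Hodge ladder) — T1 PREP («what would it take for no caveats», COORDINATOR HOME/INBOX l.13543 (3),
lead gen 16 l.13564 (T1); cite-1 g101 l.13589 «REMAINING GAPS … (β) ∃ index line `i : I V (repAt a₀) (muLiu ι₁ GramClass.rep)` at every
(F, V, a₀) — no tree theorem by name»):  THE PINNED INDEX IS INHABITED, WITH A `PhiMu` LINE OF CONTINUOUS SPLITTING, under E's orientation
`hemb : (mk ι₁).embedding = ι₁` — a corollary of ✔ `Transposition.CentralTypeAtPin.exists_line_eq_ofCM_chiSplittingLine_toHeckeCharacter`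
(pin-3, `Item6CentralTypeAtPinIndex`), ✔ `…hasCentralTypeAt_chiSplittingLine_toHeckeCharacter_weightOneType` (`Item6CentralTypeAtPin`) and
✔ `IdeleClassGroup.exists_isConjugateSymplectic_hasCMType` ([WeilBNT1967] Ch. VII §3).  Seat prover-pub-hodgecm2-rekey-l0-pin-a-g2-0.
THEOREMS ONLY (kernel lane): no definition, no instance, no notation, no section `variable` carrying a named Prop; nothing landed is edited.
FRAMING: HC_CM is NOT proved; «Δ2 BRIDGE CLOSED» is NOT claimed; nothing here is a display, a pointer move or an hM token.
-/
import Summits.HodgeConjecture.CorCM.B01.Transposition.Item6CentralTypeAtPinIndex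
import Summits.HodgeConjecture.HodgeCM.Model.LiuIndexMuLiuR2
import HarnessLib

set_option autoImplicit false

/-!
# The pinned Liu index `I V (repAt a₀) (muLiu ι₁ GramClass.rep)` is inhabited (gap (β) of the `hHom`-from-`hLiuC` route R-A, `hemb` half)

For a CM field `L`, an embedding `ι₁ : L →+* ℂ` which IS the distinguished embedding of its place (`hemb`), a hermitian 3-space `V` of
signature `(2,1)` at `ι₁`, and any pointing scalar `a₀`:

* `exists_index_fst_eq` — over EVERY Gram class `q` there is an index `j : I V (repAt a₀) (muLiu ι₁ GramClass.rep)` (`j.1 = q`): take a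
  conjugate-symplectic weight-one character `μ₀` of CM type `Φ^δ(repAt a₀ q)` ([WeilBNT1967] VII §3, `exists_isConjugateSymplectic_hasCMType`)
  and the index line `ι_{toHecke μ₀}` of pin-3's pointed constructor ([Liu2021] Prop. 4.13's weight-one summands are in the pinned index).
* `nonempty_index` — hence `Nonempty (I V (repAt a₀) (muLiu ι₁ GramClass.rep))`.
* `exists_index_phiMu_continuous` — over a class `q` with `ι₁ ∈ Φ^δ(repAt a₀ q)` the same index is a `PhiMu` line
  (`SplitLine.PhiMuLine ι₁ (line … j)`) whose pair splitting `j.2.1 = ι_{toHecke μ₀}` is CONTINUOUS ([GR91] Prop. 3.1.1) — the side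
  conditions `(hi) (hg)` under which the citation binders of the END files quantify.
* `exists_index_phiMu_continuous_self` — in particular over the pointing class `⟦a₀⟧` when `ι₁ ∈ Φ^δ(a₀)` (`repAt_mk_self`).

Orientation: WITHOUT `hemb` (i.e. `(mk ι₁).embedding = conj ∘ ι₁`) no weight-one line `ι_μ` has central type `muLiu ι₁ _ q = ∓𝟙_{w₁}`
(its central weight at `w₁` is `±1` iff `w₁.embedding ∈ Φ_μ ↔ w₁.embedding ∈ Φ^δ`, else `±2` — `Weil1964.LineSignCount.
natAbs_central_line_weightOneType_eq_one_iff`; and on agreement the sign is keyed on `conj ∘ ι₁ ∈ Φ^δ`, opposite to the table's `ι₁ ∈ Φ^δ`),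
so this file says nothing about that half (the catalogued orientation obstruction, `D2Bridge/T5IsometricBlockObstruction`, WORLD = C).
HC_CM is NOT proved.
-/

noncomputable section

namespace Summit.HodgeConjecture.CorCM.D2Bridge.IndexInhabited

open NumberField NumberField.InfinitePlace NumberField.mixedEmbedding IsDedekindDomain
open scoped Matrix Classical
open Literature.NumberTheory.Automorphic Literature.NumberTheory.Automorphic.UnitaryGroup Literature.NumberTheory.Weil1964
open Literature.NumberTheory.GelbartRogawski1991 Literature.NumberTheory.GelbartRogawski1991.UnitaryDualPair
open Literature.NumberTheory.GelbartRogawski1991.GRConstruction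
open Literature.NumberTheory.Automorphic.Liu2021.Def411WeilCarriersDoubling
open Literature.NumberTheory.Automorphic.IdeleClassGroup
open Literature.NumberTheory.GaloisRepresentations
open Literature.RepresentationTheory.HarrisKudlaSweet1996
open HodgeCM HodgeCM.Model HodgeCM.Model.LiuIndex
open HodgeCM.SignRecipe (lineType)
open HodgeCM.Model.ArchSideTerm (e₁)
open Summit.HodgeConjecture.CorCM.Transposition.CentralTypeAtPin

variable {L : CMField} {ι₁ : (L : Type) →+* ℂ}

/-- **the pinned index has an element over every Gram class** (under `hemb`): for every `q : GramClass L` there is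
`j : I V (repAt a₀) (muLiu ι₁ GramClass.rep)` with `j.1 = q` — the index line `ι_{toHecke μ₀}` of a conjugate-symplectic WEIGHT-ONE character
`μ₀` of CM type `Φ^δ(repAt a₀ q)`, which exists by [WeilBNT1967, Ch. VII §3]; pin-3's pointed constructor places it in the index.
HC_CM is NOT proved. [cite: Liu2021, Def. 4.3, Def. 4.12, Prop. 4.13 (FJcycle.tex l. 2102–2119)] [cite: WeilBNT1967, Ch. VII §3] -/
theorem exists_index_fst_eq (V : HermSpace3 L ι₁) (hemb : (InfinitePlace.mk ι₁).embedding = ι₁) (a₀ : RealScalar L)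
    (q : GramClass L) :
    ∃ j : I V (repAt a₀) (muLiu ι₁ GramClass.rep), j.1 = q := by
  obtain ⟨μ₀, hcs, hw, hΦ⟩ := exists_isConjugateSymplectic_hasCMType (L := (L : Type))
    (lineType (repAt a₀ q).1 (repAt a₀ q).2.1 (repAt a₀ q).2.2)
  obtain ⟨j, hj, -⟩ := exists_line_eq_ofCM_chiSplittingLine_toHeckeCharacter V (repAt a₀) GramClass.rep (mk_repAt a₀)
    GramClass.mk_rep hemb rfl μ₀ hcs hw hΦ
  exact ⟨j, hj⟩

/-- **`Nonempty (I V (repAt a₀) (muLiu ι₁ GramClass.rep))`** under `hemb` (gap (β) of cite-1's route R-A, `hemb` half): the universally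
quantified index binders `∀ i : I V (repAt a₀) (muLiu ι₁ GramClass.rep), …` of the END files are NOT vacuous at E's orientation.
HC_CM is NOT proved. [cite: Liu2021, Def. 4.12, Prop. 4.13] [cite: WeilBNT1967, Ch. VII §3] -/
theorem nonempty_index (V : HermSpace3 L ι₁) (hemb : (InfinitePlace.mk ι₁).embedding = ι₁) (a₀ : RealScalar L) :
    Nonempty (I V (repAt a₀) (muLiu ι₁ GramClass.rep)) :=
  let ⟨j, _⟩ := exists_index_fst_eq V hemb a₀ (GramClass.mk a₀)
  ⟨j⟩

set_option maxHeartbeats 4000000 in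
/-- **a `PhiMu` index line with CONTINUOUS pair splitting over every class of the right type** (under `hemb`): if `ι₁ ∈ Φ^δ(repAt a₀ q)` then
there is `j : I V (repAt a₀) (muLiu ι₁ GramClass.rep)` over `q` with `SplitLine.PhiMuLine ι₁ (line … j)` (the line type of an index line is
`Φ^δ` of its scalar) and `Continuous j.2.1` (its splitting is `ι_{toHecke μ₀}`, continuous by [GR91, Prop. 3.1.1]) — the two side conditions
under which the END files' citation binders quantify over the index.  HC_CM is NOT proved.
[cite: Liu2021, Def. 4.3, Def. 4.12, Prop. 4.13] [cite: GelbartRogawski1991, §3.1 Prop. 3.1.1 p. 455] [cite: WeilBNT1967, Ch. VII §3] -/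
theorem exists_index_phiMu_continuous (V : HermSpace3 L ι₁) (hemb : (InfinitePlace.mk ι₁).embedding = ι₁) (a₀ : RealScalar L)
    (q : GramClass L) (hq : ι₁ ∈ (lineType (repAt a₀ q).1 (repAt a₀ q).2.1 (repAt a₀ q).2.2).1) :
    ∃ j : I V (repAt a₀) (muLiu ι₁ GramClass.rep), j.1 = q ∧
      SplitLine.PhiMuLine ι₁ (line V (repAt a₀) (muLiu ι₁ GramClass.rep) j) ∧
        Continuous (j.2.1 : SplittingAt V (repAt a₀ j.1)) := by
  obtain ⟨μ₀, hcs, hw, hΦ⟩ := exists_isConjugateSymplectic_hasCMType (L := (L : Type))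
    (lineType (repAt a₀ q).1 (repAt a₀ q).2.1 (repAt a₀ q).2.2)
  -- the splitting `ι_{toHecke μ₀}` at the scalar `repAt a₀ q`: compatible ([GR91] Prop. 3.1.1 by definition), continuous, and of central
  -- type `centralType (weightOneType Φ^δ)` = Liu's table value `muLiu ι₁ _ q` (pin-3, under `hemb`)
  have hm := hasCentralTypeAt_chiSplittingLine_toHeckeCharacter_weightOneType V (repAt a₀ q) μ₀ hcs hw hΦ
  have E : muLiu ι₁ GramClass.rep (GramClass.mk (repAt a₀ q)) = _ :=
    (show muLiu ι₁ GramClass.rep (GramClass.mk (repAt a₀ q)) = muLiu ι₁ (repAt a₀) q by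
      rw [mk_repAt a₀ q, muLiu_eq_of_sections (ι₁ := ι₁) (repAt a₀) GramClass.rep (mk_repAt a₀) GramClass.mk_rep]).trans
      (centralType_weightOneType_lineType_eq_muLiu V (repAt a₀) hemb q).symm
  refine ⟨I.mk V (repAt a₀) (muLiu ι₁ GramClass.rep) q _ (isCompatible_chiSplittingLine (L : Type) e₁ (frameD V) (frameD_real V)
      (frameD_ne V) (toHeckeCharacter (L : Type) μ₀) (isUnitary_toHeckeCharacter (L : Type) μ₀)
      (isSplittingChar_toHeckeCharacter_of_isConjugateSymplectic (L : Type) μ₀ hcs)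
      (realDiagonal (L : Type) (RealScalar.vec (repAt a₀ q)) (RealScalar.vec_real (repAt a₀ q)))
      (realDiagonal_isSymm (L : Type) (RealScalar.vec (repAt a₀ q)) (RealScalar.vec_real (repAt a₀ q)))
      (isUnit_det_realDiagonal (L : Type) (RealScalar.vec (repAt a₀ q)) (RealScalar.vec_real (repAt a₀ q))
        (RealScalar.vec_ne (repAt a₀ q)))
      (Matrix.diagonal (RealScalar.vec (repAt a₀ q)))
      (realDiagonal_map (L : Type) (RealScalar.vec (repAt a₀ q)) (RealScalar.vec_real (repAt a₀ q))).symm) (by rw [E]; exact hm),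
    rfl, ?_, ?_⟩
  · -- `PhiMuLine ι₁ (line j) := ι₁ ∈ (line j).lineType.1`, and the line type of an index line is `Φ^δ(scalar)` (`lineOf_lineType`)
    show ι₁ ∈ _
    rw [lineOf_lineType]
    exact hq
  · exact continuous_chiSplittingLine (L : Type) e₁ (frameD V) (frameD_real V) (frameD_ne V) (toHeckeCharacter (L : Type) μ₀)
      (isUnitary_toHeckeCharacter (L : Type) μ₀) (isSplittingChar_toHeckeCharacter_of_isConjugateSymplectic (L : Type) μ₀ hcs)
      (realDiagonal (L : Type) (RealScalar.vec (repAt a₀ q)) (RealScalar.vec_real (repAt a₀ q)))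
      (isUnit_det_realDiagonal (L : Type) (RealScalar.vec (repAt a₀ q)) (RealScalar.vec_real (repAt a₀ q))
        (RealScalar.vec_ne (repAt a₀ q)))
      (Matrix.diagonal (RealScalar.vec (repAt a₀ q)))
      (realDiagonal_map (L : Type) (RealScalar.vec (repAt a₀ q)) (RealScalar.vec_real (repAt a₀ q))).symm

/-- **over the pointing class itself**: if `ι₁ ∈ Φ^δ(a₀)` there is a `PhiMu` index `j : I V (repAt a₀) (muLiu ι₁ GramClass.rep)` over `⟦a₀⟧`
with continuous pair splitting (`repAt a₀ ⟦a₀⟧ = a₀`, binder-2's `repAt_mk_self`).  HC_CM is NOT proved.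
[cite: Liu2021, Def. 4.12, Prop. 4.13] [cite: GelbartRogawski1991, §3.1 Prop. 3.1.1 p. 455] [cite: WeilBNT1967, Ch. VII §3] -/
theorem exists_index_phiMu_continuous_self (V : HermSpace3 L ι₁) (hemb : (InfinitePlace.mk ι₁).embedding = ι₁) (a₀ : RealScalar L)
    (ha₀ : ι₁ ∈ (lineType a₀.1 a₀.2.1 a₀.2.2).1) :
    ∃ j : I V (repAt a₀) (muLiu ι₁ GramClass.rep), j.1 = GramClass.mk a₀ ∧
      SplitLine.PhiMuLine ι₁ (line V (repAt a₀) (muLiu ι₁ GramClass.rep) j) ∧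
        Continuous (j.2.1 : SplittingAt V (repAt a₀ j.1)) := by
  refine exists_index_phiMu_continuous V hemb a₀ (GramClass.mk a₀) ?_
  have h : repAt a₀ (GramClass.mk a₀) = a₀ := repAt_mk_self a₀
  rw [h]
  exact ha₀

end Summit.HodgeConjecture.CorCM.D2Bridge.IndexInhabited

end
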